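import Summits.QuantumFields.YangMills.Theorems.LuscherReductionRunningReductionOneSiteTailClosed
import HarnessLib

/-!
# Registered stub `stub_oneSiteTail : Stmt.stub_oneSiteTail` of skeleton «KTR» rev 8 (crux RED `RunningReduction`,
# stmt-QuantumFields-19978) — BY NAME AND SIGNATURE, unconditional

Route `LuscherReduction` (rung R2b1), crux RED `RunningReduction` (stmt-QuantumFields-19978), registered skeleton «KTR» rev 8
(`pub/ym-beyond/p1-g19-files/Lines-KTR-r8.lean`, sha16 4d4e029b06d8e70b, `ledger skeleton check` 2026-08-27T07:22:32Z), TT door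
PART 8 «OST»: the stub `stub_oneSiteTail : Stmt.stub_oneSiteTail` with `abbrev Stmt.stub_oneSiteTail : Prop := OneSiteTail`,
`OneSiteTail` the skeleton's PART 8 text over the tree objects `levelValue`, `su2Rep`, `bareLambda`.

The gate credits a stub landing only for the VERBATIM header `theorem stub_oneSiteTail : Stmt.stub_oneSiteTail := …`
(docs/reference/gate.md A8: last name component = stub name, statement text = registered signature), and the skeleton (a pub
file) is not importable from `Theorems/`.  This module therefore re-homes the statement abbreviation with the skeleton's PART 8 text
CHARACTER FOR CHARACTER under the Theorems-side namespace `…Theorems.FemtoTransferGap.TT` (it cannot collide with the skeleton's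
`…Cruxes.RunningReduction.TT.Stmt.*`; the two are syntactically identical under the same `open`s, hence interchangeable by
`Iff.rfl`) and proves it with no hypothesis BY THE CLOSED ROUTE CHILD:

  `stub_oneSiteTail := OST.oneSiteTail_proof`

— `OST.oneSiteTail_proof : Theses.LuscherReduction.OneSiteTail` (support item stmt-QuantumFields-20204, CLOSED;
`Theorems/LuscherReductionRunningReductionOneSiteTailClosed.lean`: Hilbert–Schmidt ratio S1 + the `B`-uniform window floor S2
through `OSTail.oneSiteTail_route_of_windowFloor`).  That this term type-checks against the re-homed text is the kernel's
certificate that the skeleton stub and the route child are the same proposition (owner's split note, route rev 11/12: «children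
rfl-equal to the skeleton stub statements»).  Owner's discharge in the skeleton: `theorem stub_oneSiteTail : Stmt.stub_oneSiteTail :=
Summit.QuantumFields.YangMills.Theorems.FemtoTransferGap.TT.stub_oneSiteTail`.

`Stmt.stub_oneSiteTail` is a statement abbreviation WITH a kernel-closed witness in this very module (audit class `proved-helper`),
not a named fact: nothing under `Theorems/` takes it as a hypothesis.

HONEST FRAMING: one-site (`L = 1`) lattice quantum mechanics of the three-matrix `SU(2)` model on the femto rung R2b1 of the
CONDITIONAL Lüscher reduction route; closes ONE of seven registered stubs of RED's skeleton by name; proves nothing of the RG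
statements (`TwistedTraceScaling`, `DressedRitz`, `CoarseHandoverUpper 2`, `ExplicitNoIntruder`), nothing about infinite volume, the
continuum limit, a mass gap or Clay.  Sorry-free, no new objects, no named-fact hypotheses.
-/

set_option autoImplicit false

noncomputable section

namespace Summit.QuantumFields.YangMills.Theorems.FemtoTransferGap.TT

open Summit.QuantumFields.YangMills.Theorems.FemtoTransferGap

/-- Stub statement (M) — VERBATIM `TT.Stmt.stub_oneSiteTail := OneSiteTail` of skeleton «KTR» rev 8 (sha16 4d4e029b06d8e70b), with
the skeleton's PART 8 text of `OneSiteTail` inlined over the tree objects `levelValue`, `su2Rep`, `bareLambda`: the `B`-UNIFORM tail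
bound for the one-site femto moments — for every `s > 0` and `ε > 0` there are `K` and `B0` such that at every one-site coupling
`B ≥ B0` and every Euclidean time `T` with `s ≤ 2Tλ_b(B)` the normalised one-site transfer values `x_k = λ_k(B)/λ_0(B)` have summable
`T`-th powers with tail `Σ_k x_{k+K}^T ≤ ε`.  Syntactically identical to the closed route child `Theses.LuscherReduction.OneSiteTail`
(stmt-QuantumFields-20204).  Deliberately WITHOUT a citation tag (a re-homed skeleton statement text over Summits-side objects; the
proof below carries the citations). -/
abbrev Stmt.stub_oneSiteTail : Prop :=
  ∀ s : ℝ, 0 < s → ∀ ε : ℝ, 0 < ε → ∃ K : ℕ, ∃ B0 : ℝ, ∀ B : ℝ, B0 ≤ B → ∀ T : ℕ,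
    s ≤ 2 * ((T : ℝ) * bareLambda B) →
      Summable (fun k : ℕ => (levelValue su2Rep 1 B k / levelValue su2Rep 1 B 0) ^ T) ∧
      ∑' k : ℕ, (levelValue su2Rep 1 B (k + K) / levelValue su2Rep 1 B 0) ^ T ≤ ε

/-- ★ **Registered stub `stub_oneSiteTail` of skeleton «KTR» rev 8 (crux RED, stmt-QuantumFields-19978), BY NAME, unconditional**:
the `B`-uniform tail of the one-site femto heat trace — the closed route child `OST.oneSiteTail_proof` (stmt-QuantumFields-20204).
[cite: Luscher1983, §1] [cite: SimonB1983DiscreteSpectrum, Cor. 4] [cite: ReedSimonIV1978, Thm. XIII.1] -/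
theorem stub_oneSiteTail : Stmt.stub_oneSiteTail :=
  OST.oneSiteTail_proof

end Summit.QuantumFields.YangMills.Theorems.FemtoTransferGap.TT

end
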